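import Summits.Ventures.HSemireg.CensusG8Table
import HarnessLib

/-!
# Venture HSemireg — § g = 8 of the SIGNED verdict as a CERTIFIED NEGATIVE STATEMENT over the families tried:
# «NO-in-families-tried» is the value of the coordinator's three-outcome form on the census table of record (kernel `decide`)

HONEST FRAMING. Bookkeeping file of a COMPUTATION cell (`pub-hsemireg`, Sunday typer seat p9; referees ref-3 ∕ ref-4). The
statements below are DECIDABLE facts about the finite table `CensusG8.census` (file `CensusG8Table.lean` = CENSUS-g8 v1.273
`8eb43b237c4e60ad` transcribed row by row): counts, buckets, and the three-outcome form computed from the table. They certify that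
p9's transcription REPRODUCES the numbers and words of record of `target-g6/VERDICT-G6.md` v1.0 SIGNED `1651dcc7322662a2`, § g = 8,
and they make the negative statement precise: AMONG THE 158 LINES OF THE g = 8 CENSUS (the families tried: A, B, C, P, D + the K
calibrations), NO g = 8 ROW IS CLASS-EXACT ∧ W-ALIVE ∧ SEMIREGULAR — at any multiplicity — so no YES-candidate exists, and NO ROW
IS AN ALL-OBJECT BARRIER, so «STRUCTURAL-NO» is not claimed; the form is therefore «NO-in-families-tried». What is NOT checked
here: the engines' exact numbers behind each cell (class decompositions, Ext dimensions, σ ∕ π ranks — computed ×1…×7 by the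
cell's codes, hash-pinned in the census), the hand theorems behind the structure rows, and the modelling claims linking them to
Bloch ∕ Buchweitz–Flenner semiregularity (`Certificate.lean` states that contract). A census row is a statement about a NAMED
object or design at a NAMED anchor, never about a programme. NOTHING HERE SAYS THAT HC, HC_CM OR HC_AV IS PROVED OR REFUTED.

THE SIGNED WORDS THIS FILE TYPES (VERDICT-G6.md v1.0 § g = 8, verbatim where quoted): FORM **«NO-in-families-tried»**; «in
dimension 8 ALL rows of record incl. split ones are deciding for the cell's question as filed»; numbers «148 counted ∕ 156 listed ∕
158 physical ∕ A 43 · B 74 · C 3 · P 5 · D 14 · K 9 ∕ listed-not-counted 8 ∕ CLASS-OK tally 16 ∕ SEMIREG ∧ CLASS 0 ∕ vacuity gating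
0 ∕ candidates 0»; THREE-OUTCOME SENTENCE «YES-candidate NONE · NO-in-families-tried SUPPORTED family by family (words in INTERIM-G8
§2) · STRUCTURAL-NO NOT CLAIMED»; «No theorem of record covers ALL objects … the structural kills are FAMILY-SCOPED»; YES trigger A5
= «class ×2 + σ ×2 on a named … component» (ref-4 RISK-1: «any sheaf-row YES needs σ on two codes — trivially met, there is
none»). The theorems are grouped: (1) the roll-up numbers; (2) the negative statement; (3) the CLASS-OK tally and its 6 + 3 + 6 + 1
composition; (4) the three-outcome form; (5) the live doors (open rows) and the one class-ok ∧ σ-injective line of the whole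
table — the n = 2 calibration B19-cal2 = the signed g = 4 STEP-0 anchor 28 ∕ 18 ∕ 18 ∕ 10, a METHOD INSTANCE in print territory,
not a g = 8 row. Every proof is `decide` ∕ `rfl` on the closed table.
-/

namespace Summit.Ventures.HSemireg.CensusG8

/-! ## Predicates on rows (the census's own tests) -/

/-- «SEMIREG ∧ CLASS» for a row: CLASS-EXACT ∧ W-ALIVE and σ ∕ π injective — BOTH halves, at whatever multiplicity the cells carry
(the multiplicity is not modelled; the YES-bar A5 additionally wants ×2 in both cells). [bookkeeping] -/
def Row.semiregAndClass (r : Row) : Bool := r.cls == .ok && r.sigma == .injective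

/-- A g = 8 statement: the row's level is n = 4 (ladder ∕ companion ∕ toy rows at n ≠ 4 are carried by the census but are not
g = 8 rows). [bookkeeping] -/
def Row.atFour (r : Row) : Bool := r.n == 4

/-- The coordinator's three-outcome form (operator relay 2026-08-22T11:27:08Z (5); INTERIM-G8 §2 reading rule): «YES-candidate»
needs one g = 8 row SEMIREG+CLASS (×2 ∕ ×2); «STRUCTURAL-NO» = an all-object barrier at n = 4 stated and checked; otherwise
«NO-in-families-tried». [bookkeeping] -/
inductive Outcome | yesCandidate | structuralNo | noInFamiliesTried
  deriving DecidableEq, Repr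

/-- The three-outcome form as a FUNCTION of a census table: a YES-candidate row wins, else an all-object barrier row gives
STRUCTURAL-NO, else NO-in-families-tried. (A YES row at ×1 would already print here; the signed YES-bar is stricter.) [bookkeeping] -/
def outcome (t : List Row) : Outcome :=
  if t.any (fun r => r.atFour && r.semiregAndClass) then .yesCandidate
  else if t.any (fun r => r.atFour && r.kind == .barrierAllObjects) then .structuralNo
  else .noInFamiliesTried

/-- Number of rows of a table satisfying a Boolean test. [bookkeeping] -/
def count (t : List Row) (p : Row → Bool) : ℕ := (t.filter p).length

/-- Ids of the rows of a table satisfying a Boolean test, in table order. [bookkeeping] -/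
def ids (t : List Row) (p : Row → Bool) : List String := (t.filter p).map Row.id

/-! ## (1) The roll-up numbers of record (VERDICT-G6 v1.0 § g = 8; CENSUS-g8 §3 ∕ §5 v1.271–v1.273 «NO count change») -/

/-- 158 physical §2 table lines. [bookkeeping] -/
theorem physical_lines : census.length = 158 := by decide +kernel

/-- 156 listed rows = 158 physical − the 2 alias K-lines carried once. [bookkeeping] -/
theorem listed_rows : count census (fun r => r.status != .alias) = 156 := by decide +kernel

/-- 148 counted rows. [bookkeeping] -/
theorem counted_rows : count census (fun r => r.status == .counted) = 148 := by decide +kernel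

/-- The 8 LISTED-NOT-COUNTED rows by name (A18-15 n = 5 companion, A17-J5 n = 2 control, AW3-1 W3 sieve, PS3-3, P22-4, P22-5,
P22-5′ THEOREM EQD, P22-6), in table order. [bookkeeping] -/
theorem listedNotCounted_ids : ids census (fun r => r.status == .listedNotCounted) =
    ["A17-J5", "A18-15", "AW3-1", "PS3-3", "P22-4", "P22-5", "P22-5′", "P22-6"] := by decide +kernel

/-- The 2 alias K-lines (K22-2 ≡ K21-3, K22-3 ≡ K21-4), carried once. [bookkeeping] -/
theorem alias_ids : ids census (fun r => r.status == .alias) = ["K22-2 (≡ K21-3)", "K22-3 (≡ K21-4)"] := by decide +kernel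

/-- Counted rows per family: A 43 · B 74 · C 3 · P 5 · D 14 · K 9 (= 148). [bookkeeping] -/
theorem counted_by_family :
    (count census (fun r => r.status == .counted && r.family == .A),
     count census (fun r => r.status == .counted && r.family == .B),
     count census (fun r => r.status == .counted && r.family == .C),
     count census (fun r => r.status == .counted && r.family == .P),
     count census (fun r => r.status == .counted && r.family == .D),
     count census (fun r => r.status == .counted && r.family == .K)) = (43, 74, 3, 5, 14, 9) := by decide +kernel

/-- Listed rows per family (counted + listed-not-counted): A 46 · B 74 · C 3 · P 10 · D 14 · K 9 (= 156). [bookkeeping] -/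
theorem listed_by_family :
    (count census (fun r => r.status != .alias && r.family == .A),
     count census (fun r => r.status != .alias && r.family == .B),
     count census (fun r => r.status != .alias && r.family == .C),
     count census (fun r => r.status != .alias && r.family == .P),
     count census (fun r => r.status != .alias && r.family == .D),
     count census (fun r => r.status != .alias && r.family == .K)) = (46, 74, 3, 10, 14, 9) := by decide +kernel

/-! ## (2) The certified negative statement over the families tried -/

/-- **SEMIREG ∧ CLASS = 0 at g = 8.** No line of the census whose statement is at level n = 4 — counted or not, member,
structure row or calibration, any family, any anchor (all deciding in dimension 8) — has BOTH halves: CLASS-EXACT ∧ W-ALIVE and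
σ ∕ π injective. A fortiori no row meets the YES trigger A5 (which also wants ×2 in both cells): «candidates 0». [bookkeeping;
the cells are the census of record, transcribed] -/
theorem no_semireg_and_class_at_g8 : ∀ r ∈ census, r.n = 4 → r.semiregAndClass = false := by decide +kernel

/-- The same, counted: 0 rows. [bookkeeping] -/
theorem semireg_and_class_count_g8 : count census (fun r => r.atFour && r.semiregAndClass) = 0 := by decide +kernel

/-- **No row carries the verdict SEMIREG+CLASS** (the census's CANDIDATE word) — at any level. [bookkeeping] -/
theorem no_candidate_verdict : ∀ r ∈ census, r.verdict ≠ .semiregClass := by decide +kernel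

/-- **In the WHOLE table (all levels) exactly one line is class-exact ∧ W-alive ∧ σ-injective: the n = 2 calibration B19-cal2**
= T4a = E₀ = Φ(I_p ⊠ I_q) on E² × Ê², the signed STEP-0 g = 4 anchor (28 ∕ 18 ∕ 18 ∕ 10 reproduced by a third code) — a METHOD
INSTANCE at g = 4 (in print territory: [Mar25] ∕ [Sch88]), carried by the g = 8 census as a calibration, not a g = 8 row.
[bookkeeping] -/
theorem semireg_and_class_rows_all_levels : ids census Row.semiregAndClass = ["B19-cal2"] := by decide +kernel

/-- … and that line sits at n = 2, is a calibration row, and is counted in family B's 74. [bookkeeping] -/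
theorem semireg_and_class_rows_are_calibrations_below_four :
    ∀ r ∈ census, r.semiregAndClass = true → r.n = 2 ∧ r.kind = .calibration := by decide +kernel

/-- **MISSES-CLASS (red-6 F-3′ headline for g = 8): every σ-injective g = 8 row misses the class** — its CLASS half is never
`ok` (it is CLASS-DEAD, or the row has no class cell). 22 such rows: AE2-1, A17-3∕4, A18-1…6, A18-8…13, B20-1, B19-1, CE1-1, D21-9,
K21-1, K22-4, K20-2. [bookkeeping] -/
theorem injective_rows_miss_class : ∀ r ∈ census, r.n = 4 → r.sigma = .injective → r.cls ≠ .ok := by decide +kernel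

/-- The σ-injective g = 8 rows by name (all SEMIREG ∕ CLASS-DEAD or calibration). [bookkeeping] -/
theorem injective_rows_g8 : ids census (fun r => r.atFour && r.sigma == .injective) =
    ["AE2-1", "A17-3", "A17-4", "A18-1", "A18-2", "A18-3", "A18-4", "A18-5", "A18-6", "A18-8", "A18-9", "A18-10",
     "A18-11", "A18-12", "A18-13", "B20-1", "B19-1", "CE1-1", "D21-9", "K21-1", "K22-4", "K20-2"] := by decide +kernel

/-- **Every class-exact ∧ W-alive g = 8 row fails or lacks the σ half**: its σ cell is OBSTRUCTED, UNDECIDED or absent.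
[bookkeeping] -/
theorem classOk_rows_not_injective : ∀ r ∈ census, r.n = 4 → r.cls = .ok → r.sigma ≠ .injective := by decide +kernel

/-- The class-exact ∧ W-alive MEMBER rows (constructed objects) at g = 8 and their σ half: all OBSTRUCTED except the three
det-twist designs (σ-UNDECIDED, E₂-obstructed 12 ∕ 12, door (d7)) and the signed-cycle class witness B20-3 (not a sheaf).
[bookkeeping] -/
theorem classOk_member_rows_g8 : ids census (fun r => r.atFour && r.kind == .member && r.cls == .ok) =
    ["B20-0", "B20-3", "B20-4", "B20-5", "B20-6", "B19-6", "B19-7", "B12n4-1", "B12n4-2", "B12n4-3",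
     "D21-2", "D21-3", "D21-4", "D21-5", "D21-10"] := by decide +kernel

/-- Per family, the g = 8 negative in the census's verdict vocabulary: the COUNTED n = 4 rows of each object family A, B, C, P, D
split into SEMIREG ∕ CLASS-DEAD · CLASS-OK ∕ NOT-SEMIREG · NOT-SEMIREG · CLASS-DEAD · no-object · open ∕ undecided · structural ·
calibration, with 0 in the SEMIREG+CLASS column everywhere («NO-in-families-tried SUPPORTED family by family»). Columns in that
order; rows A, B, C, P, D, K. [bookkeeping] -/
theorem verdict_histogram_by_family_g8 :
    (let h := fun (f : Family) (v : Verdict) =>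
        count census (fun r => r.status == .counted && r.atFour && r.family == f && r.verdict == v)
     [Family.A, .B, .C, .P, .D, .K].map fun f =>
        [h f .semiregClass, h f .semiregClassDead, h f .classOkNotSemireg, h f .notSemireg, h f .classDead,
         h f .noObject, h f .openOrUndecided, h f .structural, h f .calibration]) =
    [[0, 15, 0, 0, 6, 6, 4, 10, 1],
     [0, 1, 7, 0, 7, 6, 9, 40, 1],
     [0, 0, 0, 0, 0, 0, 0, 2, 1],
     [0, 0, 0, 0, 1, 1, 1, 2, 0],
     [0, 0, 4, 3, 4, 0, 0, 2, 1],
     [0, 0, 0, 0, 0, 0, 0, 0, 5]] := by decide +kernel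

/-! ## (3) The CLASS-OK (family-B) tally of record: 16 = 6 + 3 + 6 + 1 -/

/-- The tally bucket has 16 rows, by name. [bookkeeping] -/
theorem tally_ids : ids census Row.tally =
    ["B20-0", "B20-4", "B20-5", "B20-6", "B19-3", "B19-6", "B19-7", "B19-8", "B19-20", "B19-21", "B19-22", "B19-23",
     "B19-24", "B12n4-1", "B12n4-2", "B12n4-3"] := by decide +kernel

/-- Every tally row is a counted family-B g = 8 row whose CLASS half is `ok` and whose σ half is NOT injective («0 of these is
SEMIREG»). [bookkeeping] -/
theorem tally_rows_classOk_not_semireg : ∀ r ∈ census, r.tally = true →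
    r.family = .B ∧ r.status = .counted ∧ r.n = 4 ∧ r.cls = .ok ∧ r.sigma ≠ .injective := by decide +kernel

/-- **16 = 6 + 3 + 6 + 1**: 6 member rows NOT-SEMIREG (B20-0∕4∕5∕6, B19-6∕7) + 3 det-twist design rows σ-UNDECIDED (B12n4-1∕2∕3)
+ 6 structural rows (B19-8, B19-20…24) + 1 virtual cone, not an object (B19-3). [bookkeeping] -/
theorem tally_composition :
    (count census (fun r => r.tally && r.kind == .member && r.verdict == .classOkNotSemireg),
     count census (fun r => r.tally && r.sigma == .undecided),
     count census (fun r => r.tally && r.kind == .structureRow && r.verdict != .noObject),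
     count census (fun r => r.tally && r.verdict == .noObject),
     count census Row.tally) = (6, 3, 6, 1, 16) := by decide +kernel

/-- The four sub-buckets by name. [bookkeeping] -/
theorem tally_buckets :
    (ids census (fun r => r.tally && r.kind == .member && r.verdict == .classOkNotSemireg),
     ids census (fun r => r.tally && r.sigma == .undecided),
     ids census (fun r => r.tally && r.kind == .structureRow && r.verdict != .noObject),
     ids census (fun r => r.tally && r.verdict == .noObject)) =
    (["B20-0", "B20-4", "B20-5", "B20-6", "B19-6", "B19-7"], ["B12n4-1", "B12n4-2", "B12n4-3"],
     ["B19-8", "B19-20", "B19-21", "B19-22", "B19-23", "B19-24"], ["B19-3"]) := by decide +kernel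

/-- Named outside the tally with a CLASS-OK word in the signed text: D21-2 ∕ D21-3 ∕ D21-4 (CLASS-OK ∕ NOT-SEMIREG, NEGATIVE #1 ∕ #2
readings) and B20-3 («CLASS-OK (witness)», not an object) — their cells as transcribed. [bookkeeping] -/
theorem classOk_named_outside_tally :
    ids census (fun r => !r.tally && r.family == .D && r.verdict == .classOkNotSemireg && r.kind == .member) =
      ["D21-2", "D21-3", "D21-4"] ∧
    ids census (fun r => !r.tally && r.family == .B && r.kind == .member && r.cls == .ok) = ["B20-3"] := by decide +kernel

/-! ## (4) The three-outcome form -/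

/-- **No all-object barrier row exists** (every structural kill of record is family-scoped: NOGO-n4 = scope X1, THEOREM P lineage,
(B-IV)…(B-XXII), THEOREM SQ, A-STRUCT, …) — so «STRUCTURAL-NO» is NOT claimed. [bookkeeping] -/
theorem no_allObject_barrier_row : ∀ r ∈ census, r.kind ≠ .barrierAllObjects := by decide +kernel

/-- **§ g = 8 FORM = «NO-in-families-tried»**: the three-outcome form evaluated on the census of record. [bookkeeping] -/
theorem outcome_g8 : outcome census = .noInFamiliesTried := by decide +kernel

/-- The form is STABLE under dropping the listed-not-counted and alias lines (the 148 counted rows alone give the same value).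
[bookkeeping] -/
theorem outcome_g8_counted : outcome (census.filter fun r => r.status == .counted) = .noInFamiliesTried := by decide +kernel

/-- The form reads YES-candidate as soon as SOME g = 8 row of the table has both halves (how the function is meant:
the A5 event). [bookkeeping] -/
theorem outcome_eq_yesCandidate_of_mem {t : List Row} {r : Row} (hr : r ∈ t) (h4 : r.atFour = true)
    (hs : r.semiregAndClass = true) : outcome t = .yesCandidate := by
  have h : t.any (fun r => r.atFour && r.semiregAndClass) = true :=
    List.any_eq_true.mpr ⟨r, hr, by simp [h4, hs]⟩
  rw [outcome, if_pos h]

/-- What WOULD flip it (for the record): appending any one g = 8 row with both halves makes the form read YES-candidate —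
the function is not vacuously NO on tables of this shape. [bookkeeping] -/
theorem outcome_flips_on_a_yes_row (x : String) (f : Family) (k : Kind) (v : Verdict) (b : Bool) :
    outcome (census ++ [Row.mk x f .counted 4 k .ok .injective v b]) = .yesCandidate :=
  outcome_eq_yesCandidate_of_mem (List.mem_append_right census (List.mem_singleton_self _)) rfl rfl

/-! ## (5) The live doors: OPEN ∕ UNDECIDED rows at g = 8 (no object, no number that would make a candidate) -/

/-- The 16 g = 8 rows whose verdict cell reads OPEN ∕ UNDECIDED ∕ LEAD ∕ IN PROGRESS, by name — the rows behind the signed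
LIVE-DOORS list: (d6) J-door A17-J0 ∕ J3 ∕ J6, door (3′) A17-J13 (det-2 part closed negative ×1, mixed-degree part open), (d1) =
(d2) BFIB-20 ∕ BSTAR-20 and the bisecant menus B19-15…18, (d7) the det-twist designs B12n4-1∕2∕3, (d5) ∕ door P: P22-3, PS3-3,
P22-6. None is an object with a σ number; PS3-3 and P22-6 are listed-not-counted, the other 14 counted. [bookkeeping] -/
theorem open_rows_g8 : ids census (fun r => r.atFour && r.verdict == .openOrUndecided) =
    ["A17-J0", "A17-J3", "A17-J6", "A17-J13", "BFIB-20", "BSTAR-20", "B19-15", "B19-16", "B19-17", "B19-18",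
     "B12n4-1", "B12n4-2", "B12n4-3", "P22-3", "PS3-3", "P22-6"] := by decide +kernel

/-- No open row is a constructed object with a σ number: each has σ cell UNDECIDED or none. [bookkeeping] -/
theorem open_rows_have_no_sigma_number : ∀ r ∈ census, r.verdict = .openOrUndecided → r.sigma = .undecided ∨ r.sigma = .none := by
  decide +kernel

/-- The rows carried at a level other than n = 4 (ladders n = 1, 2, 3, 5, the n = 5 companion, the odd-n emptiness row, the n = 8
toy), by name with their level — these are not g = 8 statements and are excluded from (2) by the `n = 4` guard, not by fiat.
[bookkeeping] -/
theorem rows_not_at_four : (census.filter fun r => !r.atFour).map (fun r => (r.id, r.n)) =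
    [("A17-J1", 3), ("A17-J5", 2), ("A18-15", 5), ("B19-cal1", 1), ("B19-cal2", 2), ("B19-cal3", 3), ("P22-4", 8),
     ("K21-3", 2), ("K21-4", 3), ("K22-1", 1), ("K22-2 (≡ K21-3)", 2), ("K22-3 (≡ K21-4)", 3), ("K22-5", 5)] := by decide +kernel

end Summit.Ventures.HSemireg.CensusG8
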